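import Summits.HubbardSuperconductivity.HubbardLadder.PairCorrWindowUniform
import Summits.HubbardSuperconductivity.HubbardLadder.Bounds.LUCUpperBoundsTI3
import Summits.HubbardSuperconductivity.HubbardLadder.Bounds.LUCUpperBoundsTI
import Literature.MathematicalPhysics.QuantumLattice.HubbardNNNHoppingRectSymmetries
import Literature.MathematicalPhysics.QuantumLattice.HubbardLangerMattisTorus
import HarnessLib

/-!
# Ventures/CertifiedManyBodySolver — Upper/LuctiCeilingG3.lean: the G3 glue (torus-FAMILY energy ceiling ⇒ EFFECTIVE pair-window rows)

HONEST FRAMING: first certified bounds; not a superconductivity verdict; every number certified or labelled float.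

sr-mbsolver m3-5 (`HOME/m3/doped_tl.md` §6, `PAIRING-BOUNDS.md` §0 form (E); LEAD D-11 (a) placement). The torus-FAMILY
variational claim `Bounds.luctiUpper_16k_U8_N224kk_tpm1o4_ti4ds` (pub-hubbard lucti, t' = -1/4; a `@[conjecture] def`, i.e. a
certificate sentence used as a HYPOTHESIS — nothing is asserted here) is an EFFECTIVE energy ceiling for
`PairWindowCertTT'.bound_le_avgPairCorr` on every `(16k)×(16k)` torus at the exact filling `N = 224k²` (δ = 1/8): no ε-margin,
no ineffective `L₀`. Hence ONE translation-reduced pair-window certificate `C : PairWindowCertTT' 1 (-1/4) 8 r ε` with ceiling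
field `C.u ≥ -355026702567/2^39` yields the certified one-sided bound `C.bound (16k) (112k²) ≤ ε · P̄_d(16k, r; ψ)` for EVERY
`k ≥ 1` (window injective on the torus) and EVERY unit ground state `ψ` of the sector `(224k², S^z = 0)` — theorem
`effectiveRow_16k_of_lucti_tpm1o4`. `ceiling_16k_of_lucti_tp0` is the per-site reindexing of the t' = 0 family claim
`Bounds.luctiUpper_16k_U8_N224kk_ti4ds` (value -369071688991/2^39, the V-TI1 number of CERTIFIED.md #92).
No new definitions; three theorems; hypotheses are the two family claims BY NAME.
-/

namespace Summit.Ventures.CertifiedManyBodySolver.Upper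

open Summit.HubbardSuperconductivity.HubbardLadder
open Literature.MathematicalPhysics.QuantumLattice Literature.Probability.LatticeModels Matrix Finset

/-- Step 1 (reindexing, `groundEnergy_hubbardTorusTT'_eq_rect`): the family claim as a per-site ceiling
on the square torus `hubbardTorusTT' (16k)`. -/
theorem ceiling_16k_of_lucti_tpm1o4 (h : Bounds.luctiUpper_16k_U8_N224kk_tpm1o4_ti4ds) (k : ℕ) (hk : 1 ≤ k) :
    groundEnergy (hubbardTorusTT' (16 * k) 1 ((-1 : ℝ) / 4) 8) (2 * (112 * k ^ 2)) / (((16 * k : ℕ) : ℝ)) ^ 2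
      ≤ (-355026702567 : ℝ) / 2 ^ 39 := by
  have hpos : (0 : ℝ) < ((16 * k : ℕ) : ℝ) ^ 2 := by
    have h0 : (0 : ℝ) < ((16 * k : ℕ) : ℝ) := by exact_mod_cast (by omega : 0 < 16 * k)
    positivity
  rw [groundEnergy_hubbardTorusTT'_eq_rect, div_le_iff₀ hpos]
  have h2 : 2 * (112 * k ^ 2) = 224 * k ^ 2 := by ring
  rw [h2]
  simpa [mul_comm] using h k hk

/-- Step 2 (the EFFECTIVE family row): for every `k ≥ 1` into whose torus the window fits (side written
`m + 1 = 16k` so that `avgPairCorr` elaborates with its `NeZero` side), every unit ground state `ψ` of the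
sector `(224k², S^z = 0)` of the `(16k)×(16k)` torus at `(t, t', U) = (1, -1/4, 8)` satisfies
`C.bound (16k) (112k²) ≤ ε · P̄_d(16k, r; ψ)` — given only the pair window certificate `C` (ceiling field
`C.u ≥ e_TI = -355026702567/2^39`) and the lucti family claim. At exact filling the density term of
`C.bound` vanishes iff `C.ν = 7/16` (`112k²/(16k)² = 7/16`). -/
theorem effectiveRow_16k_of_lucti_tpm1o4 {r : Site 2} {ε : ℝ}
    (C : PairWindowCertTT' 1 ((-1 : ℝ) / 4) 8 r ε) (hu : (-355026702567 : ℝ) / 2 ^ 39 ≤ C.u)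
    (h : Bounds.luctiUpper_16k_U8_N224kk_tpm1o4_ti4ds) (k m : ℕ) (hk : 1 ≤ k) (hm : m + 1 = 16 * k)
    (hInj : Set.InjOn (Torus.proj (d := 2) (m + 1)) ↑(thicken C.Λ' 1))
    {ψ : Fock (Orb (FermionTorus 2 (m + 1)))}
    (hGS : IsGroundStateInSector (hubbardTorusTT' (m + 1) 1 ((-1 : ℝ) / 4) 8) (2 * (112 * k ^ 2)) 0 ψ)
    (hψ1 : star ψ ⬝ᵥ ψ = 1) :
    C.bound (m + 1) (112 * k ^ 2) ≤ ε * avgPairCorr (m + 1) r ψ := by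
  have hL : 3 ≤ m + 1 := by omega
  have hn : 112 * k ^ 2 ≤ Fintype.card (FermionTorus 2 (m + 1)) := by
    rw [LangerMattis.card_fermionTorus_eq, hm]
    nlinarith
  have hc := ceiling_16k_of_lucti_tpm1o4 h k hk
  rw [← hm] at hc
  exact C.bound_le_avgPairCorr m hL hInj hn (hc.trans hu) hGS hψ1

/-- The same at `t' = 0` from `Bounds.luctiUpper_16k_U8_N224kk_ti4ds` (claim stated on
`groundEnergyAt (fermionRectTorusGraph (16k) (16k)) 1 8 (224k²)`; bridge `hubbardRectTorusTT'_zero`). -/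
theorem ceiling_16k_of_lucti_tp0 (h : Bounds.luctiUpper_16k_U8_N224kk_ti4ds) (k : ℕ) (hk : 1 ≤ k) :
    groundEnergy (hubbardTorusTT' (16 * k) 1 0 8) (2 * (112 * k ^ 2)) / (((16 * k : ℕ) : ℝ)) ^ 2
      ≤ (-369071688991 : ℝ) / 2 ^ 39 := by
  have hpos : (0 : ℝ) < ((16 * k : ℕ) : ℝ) ^ 2 := by
    have h0 : (0 : ℝ) < ((16 * k : ℕ) : ℝ) := by exact_mod_cast (by omega : 0 < 16 * k)
    positivity
  rw [groundEnergy_hubbardTorusTT'_eq_rect, hubbardRectTorusTT'_zero, div_le_iff₀ hpos]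
  have h2 : 2 * (112 * k ^ 2) = 224 * k ^ 2 := by ring
  rw [h2]
  simpa [groundEnergyAt, mul_comm] using h k hk

end Summit.Ventures.CertifiedManyBodySolver.Upper
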